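import Summits.QuantumFields.QCD.Theorems.ExtinctionBuildsQCD.Negative.IndexBudget
import Summits.QuantumFields.QCD.Theorems.WindowExtinction.Negative.SpectralFlow

/-!
# `ExtinctionBuildsQCD` (crux stmt-QuantumFields-8968) — negative-side support, cycle 3 (1/4):
# the Weyl window budget and TIGHT's integrand in Hermitian currency

Definition-free extract of §6a–§6b of the standing disprover's work file
`Summits/QuantumFields/QCD/Cruxes/ExtinctionBuildsQCD/Disproof.lean` (cdisprove cycle 3, 2026-08-16), built on
the landed `Negative/IndexBudget.lean` (crossing budget `abs_index_le_realModeCount`) and the sibling seat's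
`WindowExtinction/Negative/SpectralFlowLocal.lean` (Weyl counting stability `card_filter_lt_neg_le`).

* `pencil_negCount_sub_le_window` — **Weyl window budget** for a Hermitian pencil `ΓD + mΓ` (`Γ` Hermitian
  unitary): `|ν(s) − ν(t)| ≤ #{eigenvalues of H(s) in [−|t−s|, |t−s|]}`.
* `abs_negCount_sub_le_windowCount` — the same for `H_W(m) = Γ₅ D_W(U,m,1)`, every `SU(3)` gauge field
  (card `weyl-transport-unitary-pin`'s stub `negCount_hW_sub_le_modCount`, proved).
* `tight_integrand_le_window_add_realModes` — TIGHT's integrand in HERMITIAN currency: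
  `|n₋(H_W(m_crit − w_M)) − 6L⁴| ≤ #{|λ(H_W(m_crit + w_f))| ≤ w_f + w_M} + #{real λ(D_W(U,0,1)) ≤ −(m_crit + w_f)}`
  (the sharpening asked for by the triage panel, TRIAGE-r1-2 on card `tight-two-sided-pin`; = card
  `weyl-transport-unitary-pin`'s stub `index_le_unitaryModCount_add_realBand`, proved without its sign hypotheses).
* `tightIntegrand_mul_le_extinctIntegrand_mul` — weighted by the phase-quenched `∏_f |det D_W(m_f(k))|` the
  boundary atom is killed by the determinant (`fermionDet_eq_zero_of_root`), and whenever
  `a_k(m_f + M)/Z_k < c·a_k m_f/Z_k` for one flavour the TIGHT integrand is dominated POINTWISE by the EXTINCT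
  integrand — the engine of the coercivity ceiling `c ≤ 1` (`Negative/CoercivityCeiling.lean`).
References: Horn–Johnson, Matrix Analysis §4.3 (Weyl); Bhatia, Matrix Analysis Cor. III.2.6; Edwards–Heller–Narayanan,
Nucl. Phys. B 535 (1998) 403 (spectral flow of `H_W`).
-/

noncomputable section

namespace Summit.QuantumFields.QCD.Theorems.ExtinctionBuildsQCD.Negative

open scoped BigOperators Topology Classical MeasureTheory Matrix ComplexConjugate
open Filter MeasureTheory Matrix
open Literature.MathematicalPhysics.QuantumLattice Literature.MathematicalPhysics.QuantumFieldTheory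
  Literature.Probability.LatticeModels
open Summit.QuantumFields.QCD.Theses.SpectralDefectExtinction
open Summit.QuantumFields.QCD.Theorems.WindowExtinction.Negative
  (card_filter_lt_neg_le pencil_diff_bound pencil_isHermitian countP_neg_add_pos_add_zero
    countP_roots_eq_card_filter hermitianWilsonDirac_eq_pencil)

/-! ## §6a Weyl window budget for a Hermitian pencil -/

section Pencil

variable {n : Type*} [Fintype n] [DecidableEq n]

omit [DecidableEq n] in
/-- A filter contained in the union of two filters has at most the sum of their cardinalities. -/
theorem card_filter_le_add {p q r : n → Prop} [DecidablePred p] [DecidablePred q] [DecidablePred r]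
    (h : ∀ i, p i → q i ∨ r i) :
    (Finset.univ.filter p).card ≤ (Finset.univ.filter q).card + (Finset.univ.filter r).card := by
  calc (Finset.univ.filter p).card ≤ (Finset.univ.filter q ∪ Finset.univ.filter r).card :=
        Finset.card_le_card fun i hi => by
          rw [Finset.mem_union, Finset.mem_filter, Finset.mem_filter]
          rcases h i (Finset.mem_filter.1 hi).2 with h | h
          · exact Or.inl ⟨Finset.mem_univ _, h⟩
          · exact Or.inr ⟨Finset.mem_univ _, h⟩
    _ ≤ _ := Finset.card_union_le _ _

omit [Fintype n] [DecidableEq n] in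
/-- Monotonicity of `Multiset.countP` in the predicate (any type). -/
theorem countP_le_countP_of_imp {α : Type*} (s : Multiset α) {p q : α → Prop} [DecidablePred p]
    [DecidablePred q] (h : ∀ x, p x → q x) : s.countP p ≤ s.countP q := by
  rw [Multiset.countP_eq_card_filter, Multiset.countP_eq_card_filter]
  exact Multiset.card_le_card (Multiset.monotone_filter_right s h)

variable {Γ D : Matrix n n ℂ}

/-- **Weyl window budget for the pencil `H(m) = ΓD + mΓ`** (`Γ` a Hermitian unitary, `ΓD` Hermitian):
the negative-eigenvalue counts at two parameters differ by at most the number of eigenvalues of `H(s)`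
in the closed window `[−|t − s|, |t − s|]`. Proof: `‖H(t) − H(s)‖ ≤ |t − s|`, so by counting stability
(`card_filter_lt_neg_le`, Weyl) `#{λ(H s) < −w} ≤ ν(t)` and `#{λ(H s) > w} ≤ π(t) ≤ N − ν(t)`. -/
theorem pencil_negCount_sub_le_window (hΓ : Γᴴ = Γ) (hΓ2 : Γ * Γ = 1) (hD : (Γ * D)ᴴ = Γ * D)
    (s t : ℝ) :
    |((Γ * D + (s : ℂ) • Γ).charpoly.roots.countP (fun z => z.re < 0) : ℤ) -
        ((Γ * D + (t : ℂ) • Γ).charpoly.roots.countP (fun z => z.re < 0) : ℤ)| ≤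
      ((Γ * D + (s : ℂ) • Γ).charpoly.roots.countP (fun z => |z.re| ≤ |t - s|) : ℤ) := by
  set w : ℝ := |t - s| with hw
  have hw0 : 0 ≤ w := abs_nonneg _
  have hA := pencil_isHermitian (D := D) hΓ hD s
  have hB := pencil_isHermitian (D := D) hΓ hD t
  have hE : ∀ v : n → ℂ,
      |(star v ⬝ᵥ ((Γ * D + (t : ℂ) • Γ) - (Γ * D + (s : ℂ) • Γ)) *ᵥ v).re| ≤ w * ∑ i, ‖v i‖ ^ 2 :=
    pencil_diff_bound hΓ hΓ2 s t
  have h1 : (Finset.univ.filter fun i => hA.eigenvalues i < -w).card ≤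
      (Finset.univ.filter fun i => hB.eigenvalues i < 0).card := by
    convert card_filter_lt_neg_le hA hB (σ := 1) (δ := w) (Or.inl rfl) hE using 3 <;> simp
  have h2 : (Finset.univ.filter fun i => w < hA.eigenvalues i).card ≤
      (Finset.univ.filter fun i => 0 < hB.eigenvalues i).card := by
    convert card_filter_lt_neg_le hA hB (σ := -1) (δ := w) (Or.inr rfl) hE using 3 <;> simp
  have htri := countP_neg_add_pos_add_zero hB
  rw [countP_roots_eq_card_filter hB (· < 0), countP_roots_eq_card_filter hB (0 < ·),
    countP_roots_eq_card_filter hB (· = 0)] at htri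
  rw [countP_roots_eq_card_filter hA (· < 0), countP_roots_eq_card_filter hB (· < 0),
    countP_roots_eq_card_filter hA (fun x => |x| ≤ w)]
  -- (a) `ν(s) ≤ #{λ(H s) < -w} + window`
  have ha : (Finset.univ.filter fun i => hA.eigenvalues i < 0).card ≤
      (Finset.univ.filter fun i => hA.eigenvalues i < -w).card +
        (Finset.univ.filter fun i => |hA.eigenvalues i| ≤ w).card :=
    card_filter_le_add fun i hi => by
      by_cases h : hA.eigenvalues i < -w
      · exact Or.inl h
      · exact Or.inr (abs_le.2 ⟨not_lt.1 h, by linarith⟩)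
  -- (b) `#{λ(H s) ≤ w} ≤ ν(s) + window`
  have hb : (Finset.univ.filter fun i => ¬ w < hA.eigenvalues i).card ≤
      (Finset.univ.filter fun i => hA.eigenvalues i < 0).card +
        (Finset.univ.filter fun i => |hA.eigenvalues i| ≤ w).card :=
    card_filter_le_add fun i hi => by
      by_cases h : hA.eigenvalues i < 0
      · exact Or.inl h
      · exact Or.inr (abs_le.2 ⟨by linarith [not_lt.1 h], not_lt.1 hi⟩)
  have hN := Finset.card_filter_add_card_filter_not (s := (Finset.univ : Finset n))
    (fun i => w < hA.eigenvalues i)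
  have hNB := Finset.card_filter_add_card_filter_not (s := (Finset.univ : Finset n))
    (fun i => hB.eigenvalues i < 0)
  have hsub : (Finset.univ.filter fun i => 0 < hB.eigenvalues i).card ≤
      (Finset.univ.filter fun i => ¬ hB.eigenvalues i < 0).card :=
    Finset.card_le_card fun i hi => by
      rw [Finset.mem_filter] at hi ⊢
      exact ⟨hi.1, fun h => lt_asymm h hi.2⟩
  rw [abs_le]
  constructor <;> omega

end Pencil

/-! ## §6b The Wilson instance and TIGHT's integrand in Hermitian currency -/

section Wilson

variable {L : ℕ} [NeZero L]

/-- **Weyl window budget for the Hermitian Wilson–Dirac operator.** For every `SU(3)` gauge field and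
bare masses `a`, `b`: `|n₋(Γ₅D_W(U,a,1)) − n₋(Γ₅D_W(U,b,1))| ≤ #{eigenvalues λ of Γ₅D_W(U,a,1) with |λ| ≤ |b − a|}`
(`Γ₅D_W(U,b,1) = Γ₅D_W(U,a,1) + (b−a)Γ₅`, `‖Γ₅‖ = 1`, Weyl). -/
theorem abs_negCount_sub_le_windowCount (U : GaugeConfig 4 L SU3) (a b : ℝ) :
    |(Multiset.countP (fun z : ℂ => z.re < 0)
        (spinorLift gammaFive * wilsonDirac (fundamentalRep (Fin 3)) U a 1).charpoly.roots : ℤ) -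
      Multiset.countP (fun z : ℂ => z.re < 0)
        (spinorLift gammaFive * wilsonDirac (fundamentalRep (Fin 3)) U b 1).charpoly.roots| ≤
      Multiset.countP (fun z : ℂ => |z.re| ≤ |b - a|)
        (spinorLift gammaFive * wilsonDirac (fundamentalRep (Fin 3)) U a 1).charpoly.roots := by
  have hρ : ∀ g : SU3, fundamentalRep (Fin 3) g ∈ Matrix.unitaryGroup (Fin 3) ℂ :=
    fundamentalRep_mem_unitaryGroup
  rw [hermitianWilsonDirac_eq_pencil _ hρ U a, hermitianWilsonDirac_eq_pencil _ hρ U b]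
  exact pencil_negCount_sub_le_window conjTranspose_spinorLift_gammaFive' spinorLift_gammaFive_mul_self
    (Literature.Barriers.QuantumFields.WilsonDeterminant.isHermitian_hermitianWilsonDirac _ hρ U 0 1) a b

/-- **TIGHT's integrand in Hermitian currency** (sharpening of `tight_integrand_le_signDefects_add_band`).
For a line at `m_crit`, a flavour window `w_f ≥ 0` and a probe depth `w_M ≥ 0`, on EVERY gauge field:
`|n₋(Γ₅D_W(U, m_crit − w_M, 1)) − 6L⁴| ≤ #{λ(Γ₅D_W(U, m_crit + w_f, 1)) : |λ| ≤ w_f + w_M}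
  + #{real λ(D_W(U,0,1)) : λ ≤ −(m_crit + w_f)}` —
a WINDOW count of the Hermitian operator AT THE FLAVOUR MASS (the currency of EXTINCT(b)) plus the real
modes at or below the flavour threshold (EXTINCT(a)'s sign defects plus the boundary atom). Weyl from the
flavour mass down to the probe, crossing budget (`abs_index_le_realModeCount`) from the flavour mass up. -/
theorem tight_integrand_le_window_add_realModes (U : GaugeConfig 4 L SU3) (mcrit wf wM : ℝ)
    (hwf : 0 ≤ wf) (hwM : 0 ≤ wM) :
    |(Multiset.countP (fun z : ℂ => z.re < 0)
        (spinorLift gammaFive * wilsonDirac (fundamentalRep (Fin 3)) U (mcrit - wM) 1).charpoly.roots : ℤ) -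
      6 * (L : ℤ) ^ 4| ≤
      (Multiset.countP (fun z : ℂ => |z.re| ≤ wf + wM)
          (spinorLift gammaFive * wilsonDirac (fundamentalRep (Fin 3)) U (mcrit + wf) 1).charpoly.roots : ℤ) +
        (Multiset.countP (fun z : ℂ => z.im = 0 ∧ z.re ≤ -(mcrit + wf))
          (wilsonDirac (fundamentalRep (Fin 3)) U 0 1).charpoly.roots : ℤ) := by
  have h1 := abs_negCount_sub_le_windowCount U (mcrit + wf) (mcrit - wM)
  have h2 := abs_index_le_realModeCount U (mcrit + wf)
  have hw : |mcrit - wM - (mcrit + wf)| = wf + wM := by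
    rw [show mcrit - wM - (mcrit + wf) = -(wf + wM) by ring, abs_neg, abs_of_nonneg (by linarith)]
  rw [hw, abs_sub_comm] at h1
  set nP := (Multiset.countP (fun z : ℂ => z.re < 0)
    (spinorLift gammaFive * wilsonDirac (fundamentalRep (Fin 3)) U (mcrit - wM) 1).charpoly.roots : ℤ)
  set nF := (Multiset.countP (fun z : ℂ => z.re < 0)
    (spinorLift gammaFive * wilsonDirac (fundamentalRep (Fin 3)) U (mcrit + wf) 1).charpoly.roots : ℤ)
  calc |nP - 6 * (L : ℤ) ^ 4| = |(nP - nF) + (nF - 6 * (L : ℤ) ^ 4)| := by ring_nf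
    _ ≤ |nP - nF| + |nF - 6 * (L : ℤ) ^ 4| := abs_add_le _ _
    _ ≤ _ := add_le_add h1 h2

/-- **A real eigenvalue of `D_W(U,0,1)` at `−μ` kills the determinant of `D_W(U,μ,1)`.** -/
theorem fermionDet_eq_zero_of_root (U : GaugeConfig 4 L SU3) (μ : ℝ) {z : ℂ}
    (hz : z ∈ (wilsonDirac (fundamentalRep (Fin 3)) U 0 1).charpoly.roots) (hzμ : z = ((-μ : ℝ) : ℂ)) :
    fermionDet (wilsonDirac (fundamentalRep (Fin 3)) U μ 1) = 0 := by
  set D₀ := wilsonDirac (fundamentalRep (Fin 3)) U 0 1 with hD₀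
  have hne : D₀.charpoly ≠ 0 := (Matrix.charpoly_monic _).ne_zero
  have heval : (Matrix.scalar _ z - D₀).det = 0 := by
    rw [← Matrix.eval_charpoly]; exact (Polynomial.mem_roots hne).1 hz
  show (wilsonDirac (fundamentalRep (Fin 3)) U μ 1).det = 0
  rw [wilsonDirac_mass_eq_add_scalar (fundamentalRep (Fin 3)) U μ 1]
  have hmat : wilsonDirac (fundamentalRep (Fin 3)) U 0 1 + Matrix.scalar _ ((μ : ℝ) : ℂ) =
      -(Matrix.scalar _ z - D₀) := by
    rw [neg_sub, sub_eq_add_neg, ← map_neg, hzμ, Complex.ofReal_neg, neg_neg]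
  rw [hmat, Matrix.det_neg, heval, mul_zero]

/-- Real modes at or below a threshold = sign defects strictly below + the boundary atom. -/
theorem countP_realModes_le_eq (U : GaugeConfig 4 L SU3) (t : ℝ) :
    Multiset.countP (fun z : ℂ => z.im = 0 ∧ z.re ≤ t) (wilsonDirac (fundamentalRep (Fin 3)) U 0 1).charpoly.roots =
      Multiset.countP (fun z : ℂ => z.im = 0 ∧ z.re < t) (wilsonDirac (fundamentalRep (Fin 3)) U 0 1).charpoly.roots +
        Multiset.countP (fun z : ℂ => z = ((t : ℝ) : ℂ)) (wilsonDirac (fundamentalRep (Fin 3)) U 0 1).charpoly.roots := by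
  set R := (wilsonDirac (fundamentalRep (Fin 3)) U 0 1).charpoly.roots
  rw [Multiset.countP_eq_countP_filter_add R (fun z : ℂ => z.im = 0 ∧ z.re ≤ t) (fun z : ℂ => z.re < t),
    Multiset.countP_filter, Multiset.countP_filter]
  congr 1
  · exact Multiset.countP_congr rfl fun z _ => propext
      ⟨fun h => ⟨h.1.1, h.2⟩, fun h => ⟨⟨h.1, h.2.le⟩, h.2⟩⟩
  · refine Multiset.countP_congr rfl fun z _ => propext ⟨fun h => ?_, fun h => ?_⟩
    · have hre : z.re = t := le_antisymm h.1.2 (not_lt.1 h.2)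
      exact Complex.ext (by simp [hre]) (by simp [h.1.1])
    · subst h
      exact ⟨⟨by simp, by simp⟩, by simp⟩

/-- **Pointwise domination of TIGHT by EXTINCT (one flavour's window is enough).** For witness data
`(reg, c)` at step `k`, a mass tuple `m`, a probe parameter `M ≥ 0` and a flavour `f₀` with `m_{f₀} ≥ 0` and
`m_{f₀} + M < c · m_{f₀}` (possible iff `c > 1`), on EVERY gauge field of the torus of side `2L'+1`: the
TIGHT integrand times the phase-quenched weight `∏_f |det D_W(U, m_f(k), 1)|` is at most the EXTINCT
integrand times the same weight. (Weyl window `a_k(m_{f₀}+M)/Z_k` inside EXTINCT(b)'s window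
`c a_k m_{f₀}/Z_k`; the real modes `≤ −m_{f₀}(k)` are EXTINCT(a)'s sign defects plus the atom at
`−m_{f₀}(k)`, on which the weight vanishes: `det D_W(U, m_{f₀}(k), 1) = 0`.) -/
theorem tightIntegrand_mul_le_extinctIntegrand_mul {Nf L' : ℕ} (U : GaugeConfig 4 (2 * L' + 1) SU3)
    (reg : QCDRegularisation Nf) (c : ℝ) (k : ℕ) (m : Fin Nf → ℝ) (M : ℝ) (f₀ : Fin Nf)
    (hm : 0 ≤ m f₀) (hM : 0 ≤ M) (hwin : m f₀ + M < c * m f₀) :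
    |(Multiset.countP (fun z : ℂ => z.re < 0) (spinorLift gammaFive * wilsonDirac (fundamentalRep (Fin 3)) U (reg.mcrit k - reg.a k * M / reg.Zm k) 1).charpoly.roots : ℝ) - 6 * (2 * L' + 1 : ℝ) ^ 4| * ∏ f : Fin Nf, ‖fermionDet (wilsonDirac (fundamentalRep (Fin 3)) U (reg.mcrit k + reg.a k * m f / reg.Zm k) 1)‖ ≤
      (∑ f : Fin Nf, ((Multiset.countP (fun z : ℂ => z.im = 0 ∧ z.re < -(reg.mcrit k + reg.a k * m f / reg.Zm k)) (wilsonDirac (fundamentalRep (Fin 3)) U 0 1).charpoly.roots : ℝ) + (Multiset.countP (fun z : ℂ => |z.re| < c * (reg.a k * m f / reg.Zm k)) (spinorLift gammaFive * wilsonDirac (fundamentalRep (Fin 3)) U (reg.mcrit k + reg.a k * m f / reg.Zm k) 1).charpoly.roots : ℝ))) * ∏ f : Fin Nf, ‖fermionDet (wilsonDirac (fundamentalRep (Fin 3)) U (reg.mcrit k + reg.a k * m f / reg.Zm k) 1)‖ := by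
  set wf : ℝ := reg.a k * m f₀ / reg.Zm k with hwf
  set wM : ℝ := reg.a k * M / reg.Zm k with hwM
  set W : ℝ := ∏ f : Fin Nf, ‖fermionDet (wilsonDirac (fundamentalRep (Fin 3)) U
    (reg.mcrit k + reg.a k * m f / reg.Zm k) 1)‖ with hW
  have hwf0 : 0 ≤ wf := div_nonneg (mul_nonneg (reg.a_pos k).le hm) (reg.Zm_pos k).le
  have hwM0 : 0 ≤ wM := div_nonneg (mul_nonneg (reg.a_pos k).le hM) (reg.Zm_pos k).le
  have hW0 : 0 ≤ W := Finset.prod_nonneg fun f _ => norm_nonneg _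
  -- the window of `f₀` fits inside EXTINCT(b)'s window
  have hwin' : wf + wM < c * wf := by
    have h1 : reg.a k * (m f₀ + M) / reg.Zm k < reg.a k * (c * m f₀) / reg.Zm k :=
      div_lt_div_of_pos_right (mul_lt_mul_of_pos_left hwin (reg.a_pos k)) (reg.Zm_pos k)
    have e1 : reg.a k * (m f₀ + M) / reg.Zm k = wf + wM := by rw [hwf, hwM]; ring
    have e2 : reg.a k * (c * m f₀) / reg.Zm k = c * wf := by rw [hwf]; ring
    linarith
  -- the atom
  by_cases hatom : Multiset.countP (fun z : ℂ => z = ((-(reg.mcrit k + wf) : ℝ) : ℂ)) (wilsonDirac (fundamentalRep (Fin 3)) U 0 1).charpoly.roots = 0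
  · -- no real eigenvalue exactly at the flavour threshold: Hermitian-currency budget, cast to `ℝ`
    have hZ := tight_integrand_le_window_add_realModes U (reg.mcrit k) wf wM hwf0 hwM0
    rw [countP_realModes_le_eq U, hatom, add_zero] at hZ
    have hRe : |(Multiset.countP (fun z : ℂ => z.re < 0) (spinorLift gammaFive * wilsonDirac (fundamentalRep (Fin 3)) U (reg.mcrit k - wM) 1).charpoly.roots : ℝ) - 6 * (2 * L' + 1 : ℝ) ^ 4| ≤
        (Multiset.countP (fun z : ℂ => |z.re| ≤ wf + wM) (spinorLift gammaFive * wilsonDirac (fundamentalRep (Fin 3)) U (reg.mcrit k + wf) 1).charpoly.roots : ℝ) +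
          (Multiset.countP (fun z : ℂ => z.im = 0 ∧ z.re < -(reg.mcrit k + wf)) (wilsonDirac (fundamentalRep (Fin 3)) U 0 1).charpoly.roots : ℝ) := by
      exact_mod_cast hZ
    -- window ≤ coercivity defects of `f₀`, sign defects of `f₀` ≤ the flavour sum
    have hwin_le : (Multiset.countP (fun z : ℂ => |z.re| ≤ wf + wM) (spinorLift gammaFive * wilsonDirac (fundamentalRep (Fin 3)) U (reg.mcrit k + wf) 1).charpoly.roots : ℝ) ≤
        (Multiset.countP (fun z : ℂ => |z.re| < c * wf) (spinorLift gammaFive * wilsonDirac (fundamentalRep (Fin 3)) U (reg.mcrit k + wf) 1).charpoly.roots : ℝ) := by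
      exact_mod_cast countP_le_countP_of_imp (p := fun z : ℂ => |z.re| ≤ wf + wM)
        (q := fun z : ℂ => |z.re| < c * wf) _ fun z hz => lt_of_le_of_lt hz hwin'
    have hsum : (Multiset.countP (fun z : ℂ => z.im = 0 ∧ z.re < -(reg.mcrit k + wf)) (wilsonDirac (fundamentalRep (Fin 3)) U 0 1).charpoly.roots : ℝ) +
        (Multiset.countP (fun z : ℂ => |z.re| < c * wf) (spinorLift gammaFive * wilsonDirac (fundamentalRep (Fin 3)) U (reg.mcrit k + wf) 1).charpoly.roots : ℝ) ≤
        ∑ f : Fin Nf, ((Multiset.countP (fun z : ℂ => z.im = 0 ∧ z.re < -(reg.mcrit k + reg.a k * m f / reg.Zm k)) (wilsonDirac (fundamentalRep (Fin 3)) U 0 1).charpoly.roots : ℝ) + (Multiset.countP (fun z : ℂ => |z.re| < c * (reg.a k * m f / reg.Zm k)) (spinorLift gammaFive * wilsonDirac (fundamentalRep (Fin 3)) U (reg.mcrit k + reg.a k * m f / reg.Zm k) 1).charpoly.roots : ℝ)) :=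
      Finset.single_le_sum (f := fun f : Fin Nf => ((Multiset.countP (fun z : ℂ => z.im = 0 ∧ z.re < -(reg.mcrit k + reg.a k * m f / reg.Zm k)) (wilsonDirac (fundamentalRep (Fin 3)) U 0 1).charpoly.roots : ℝ) + (Multiset.countP (fun z : ℂ => |z.re| < c * (reg.a k * m f / reg.Zm k)) (spinorLift gammaFive * wilsonDirac (fundamentalRep (Fin 3)) U (reg.mcrit k + reg.a k * m f / reg.Zm k) 1).charpoly.roots : ℝ)))
        (fun f _ => by positivity) (Finset.mem_univ f₀)
    have key := (hRe.trans (add_le_add hwin_le le_rfl)).trans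
      (le_of_eq_of_le (add_comm _ _) hsum)
    exact mul_le_mul_of_nonneg_right key hW0
  · -- a real eigenvalue exactly at `−m_{f₀}(k)`: the weight vanishes
    obtain ⟨z, hzR, hz⟩ : ∃ z ∈ (wilsonDirac (fundamentalRep (Fin 3)) U 0 1).charpoly.roots, z = ((-(reg.mcrit k + wf) : ℝ) : ℂ) := by
      by_contra hcon
      push Not at hcon
      exact hatom (Multiset.countP_eq_zero.2 fun z hz h => hcon z hz h)
    have hdet : fermionDet (wilsonDirac (fundamentalRep (Fin 3)) U (reg.mcrit k + wf) 1) = 0 :=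
      fermionDet_eq_zero_of_root U (reg.mcrit k + wf) hzR hz
    have hWz : W = 0 :=
      Finset.prod_eq_zero (Finset.mem_univ f₀) (by rw [← hwf, hdet, norm_zero])
    rw [hWz, mul_zero, mul_zero]

end Wilson


end Summit.QuantumFields.QCD.Theorems.ExtinctionBuildsQCD.Negative

end
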